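import Literature.NumberTheory.EllipticCurves.Sprung2012.HondaLevelTwoFreeCoordinatesOntoProofs
import Literature.NumberTheory.EllipticCurves.Sprung2012.ColemanMapJointLinearProofs
import Literature.NumberTheory.EllipticCurves.Sprung2012.LocalTowerLayersProofs
import Literature.NumberTheory.EllipticCurves.LocalPointsFiniteIndexLatticeProofs
import HarnessLib

/-!
# Sprung 2012 §§2, 7 / (SES-KP): the point-independence clause (IND) of the COKERNEL of the joint Coleman map
# `Col = (Col♯, Col♭)` DISCHARGED from Silverman AEC VII.6.3 — `c₋₁` and `q` are `𝔽_p`-independent in `E(K_∞·K_v)/p`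
# (proofs only)

Topic `Literature/NumberTheory/EllipticCurves`, cluster `Sprung2012` (namespace = path). A THEOREMS file (no definition, no
named fact; net Literature debt `0`). Cell `bsd-ssimc`, width seat `cruxlead-stmt-BirchSwinnertonDyer-19875-w3` (gen 7), in
support of the x8 cruxes stmt-BirchSwinnertonDyer-22569 `KatoFineLowerSporadicX8` / 22901 `CyclotomicLowerPosLevelX8` through
the cokernel bound F-α (`Summits/…/SignedLowerHalvesSprungLowerDivisibilityAtThreeCokerBoundSkeleton.lean`, hypothesis `hcoker`).
F. E. I. Sprung, *Iwasawa theory for elliptic curves at supersingular primes: A pair of main conjectures*, J. Number Theory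
**132** (2012) [Sprung2012]; M. Kurihara, R. Pollack (2007) Prop. 1.2 and A. Lei, R. Sujatha (2021) §3 for the exact sequence
(SES-KP) `0 → H¹_Iw(T) → Λ² → ℤ_p → 0`. The cokernel half «`T·Λ² ⊆ Col(H¹_Iw)`» was proved in
`Sprung2012/ColemanMapJointCokernelProofs.lean` (w2 g8) MODULO the clause (IND) «`c₋₁` and
`q = ∑_{j<p²} C(j,p)·gʲc_2 − 2·∑_{j<p} j·gʲc_1` are `𝔽_p`-independent in `E(K_∞·K_v)/p`», a RANK statement the tree's
`IsHondaSystem` (generation in dual form) cannot supply. THIS file proves (IND) from the named fact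
`silvermanVII63_localLayerPoints_finiteIndex_zpLattice` (Silverman AEC VII Prop. 6.3 with IV Thm. 6.4 (b): `E(K_2·K_v) ⊇` a
finite-index subgroup `≅ ℤ_p^{[K_2·K_v : ℚ_p]}`; INPUTS desk, `LocalPointsFiniteIndexLattice.lean`) — so that over `ℚ` at an
odd supersingular prime the cokernel of the joint Coleman map is `Λ/(T)` CONDITIONALLY ONLY on that cite-only textbook fact
(`forall_exists_isColemanPair_X_mul_rat_of_silvermanVII63`, `exists_linearMap_isColemanPair_cokernel_rat_of_silvermanVII63`).

## The proof

1. (part 1, `Sprung2012/HondaLevelTwoFreeCoordinatesOntoProofs.lean`, `exists_functional_of_coordinates`) modulo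
   Silverman VII.6.3 at layer `2`, EVERY vector of `ℤ_p^{p²}` is the free-coordinate vector
   `((z(gʳc_1))_{r<p}, (z(g^{r+pi}c_2))_{r<p,i<p−1})` of a functional `z` on `E(K_2·K_v)`.
2. (`exists_pair_det_not_dvd`, `p` odd) Two functionals `z₀, z₁` on `E(K_2·K_v)` with
   `z₀(c₋₁)·z₁(q) − z₁(c₋₁)·z₀(q) = u⁻¹ ∈ ℤ_pˣ` (`u = a_p(a_p−2) − (p−1)`): `z₀` with coordinates `y = δ_0`,
   `x_{r,0} = a_pδ_{r,0} − (a_p−2)u⁻¹`, `x_{r,i≥1} = 0` (then `z₀(c₋₁) = u⁻¹`, all dependent orbit values vanish and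
   `z₀(q) = 0` as `C(j,p) = 0` for `j < p`); `z₁` with `y = 0`, `x_{0,1} = 1`, `x_{0,0} = −1` (then `z₁(c₋₁) = 0`,
   `z₁(q) = C(p,p) − C(0,p) = 1`).
3. (`honda_independent`) If `p·y = m₀c₋₁ + m₁q` with `y ∈ E(K_∞·K_v)` then `y ∈ E(K_2·K_v)` (no `p`-torsion in the tower,
   `mem_localLayerPointsOfEmb_of_pow_nsmul_mem`), and applying `z₀, z₁` gives `p ∣ m₀D`, `p ∣ m₁D` with `D` a unit (Cramer),
   so `p ∣ m₀, m₁`.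
4. Over `ℚ`: `p ≠ 2` good supersingular ⇒ no `p`-torsion (Lemma 2.3 discharged, `LocalTowerNoPTorsionProofs`), `e(p|p)f(p|p) =
   1` (`silvermanVII63_localLayerPoints_finiteIndex_zpLattice.rat`): `honda_independent_rat`; fed into
   `forall_exists_isColemanPair_X_mul_rat` / `exists_linearMap_isColemanPair_cokernel_rat`.

HONEST FRAMING: everything over `ℚ` here is CONDITIONAL on the cite-only named fact
`silvermanVII63_localLayerPoints_finiteIndex_zpLattice` (hypothesis `h63`; Silverman AEC VII.6.3, a textbook theorem typed
but not proved in the tree); nothing about any Selmer group, the ♯/♭ main conjectures or BSD is asserted or proved; the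
Birch–Swinnerton-Dyer conjecture is NOT proved by any of this.

## References
* [Sprung2012] F. E. I. Sprung, J. Number Theory 132 (2012) 1483–1506: Thm. 2.2, Lemma 2.3, Cor. 2.10 (pp. 1487–1489);
  Def. 3.1 (p. 1489); Def. 5.9 (p. 1495); Def. 7.1–7.2, Props. 7.3/7.6, Lemmas 7.4–7.5 (pp. 1500–1501); Lemma 7.10 (p. 1503).
* [SilvermanAEC2009] J. H. Silverman, *The Arithmetic of Elliptic Curves*, 2nd ed., VII Prop. 6.3, IV Thm. 6.4 (b).
* [KuriharaPollack2007] M. Kurihara, R. Pollack, Prop. 1.2. [LeiSujatha2021] A. Lei, R. Sujatha, §3 (SES-KP).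
* Tree: `Sprung2012/{ColemanMaps, HondaLevelTwoRelationsProofs, HondaLevelTwoDualCoordinatesProofs,
  HondaLevelTwoFreeCoordinatesOntoProofs, ColemanMapJointCokernelProofs, ColemanMapJointLinearProofs, LocalTowerLayersProofs,
  LocalTowerNoPTorsionProofs}.lean`, `LocalPointsFiniteIndexLattice[Proofs].lean`.
-/

noncomputable section

open scoped Classical NumberField

open Polynomial Finset

universe u

namespace Literature.NumberTheory.EllipticCurves.Sprung2012

open Literature.NumberTheory.EllipticCurves Literature.NumberTheory.GaloisRepresentations ZpExtension
  Literature.NumberTheory.EllipticCurves.Kobayashi2003 Literature.NumberTheory.EllipticCurves.Sprung2017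

/-! ## §0 `ℤ_p`-units -/

section Unit

variable {p : ℕ} [Fact p.Prime]

/-- Units of `ℤ_p` are the elements not divisible by `p`. [folklore] -/
private theorem isUnit_iff_not_dvd {a : ℤ_[p]} : IsUnit a ↔ ¬ (p : ℤ_[p]) ∣ a := by
  rw [PadicInt.isUnit_iff, ← PadicInt.norm_lt_one_iff_dvd, not_lt, le_antisymm_iff,
    and_iff_right (PadicInt.norm_le_one a)]

end Unit

section Local

variable {K : Type u} [Field K] {p : ℕ} [Fact p.Prime] {κ : ZpExtension K p}
variable {E : Type u} [Field E] [Algebra K E] {ι : AlgebraicClosure K →ₐ[K] AlgebraicClosure E}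
variable {W : WeierstrassCurve K}

/-! ## §1 Two functionals with unit determinant on `(c₋₁, q)` (`p` odd) -/

/-- **Two functionals `z₀, z₁` on `E(K_2·K_v)` separating `c₋₁` and `q` modulo `p`**:
`p ∤ z₀(c₋₁)·z₁(q) − z₁(c₋₁)·z₀(q)` (`p` odd, `p ∣ a_p`, Honda system, Silverman VII.6.3 at layer `2`). Construction by
free coordinates (`exists_functional_of_coordinates`): `z₀` has `y = δ_0`, `x_{r,0} = a_pδ_{r,0} − (a_p−2)u⁻¹` and
`x_{r,i} = 0` for `i ≥ 1`, whence `z₀(c₋₁) = u⁻¹`, all dependent orbit values `0`, `z₀(q) = 0` (`C(j,p) = 0` for `j < p`);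
`z₁` has `y = 0`, `x_{0,1} = 1`, `x_{0,0} = −1`, whence `z₁(c₋₁) = 0`, `z₁(q) = C(p,p) − C(0,p) = 1`. (In the `𝔽_p[N]`-module
`E(K_2·K_v)/p`, `N = g−1`: `c̄₋₁` and `q̄ − 2c̄₋₁ = 2N^{p−2}c̄_1 − N^{p²−p−1}c̄_2` are independent socle vectors.)
[cite: Sprung2012, Thm. 2.2, Lemma 2.3 (pp. 1487–1488), Cor. 2.10 (p. 1489)] [cite: SilvermanAEC2009, VII Prop. 6.3] -/
theorem exists_pair_det_not_dvd {ap : ℤ} (hap : (p : ℤ) ∣ ap) (hp2 : p ≠ 2) {g : Field.absoluteGaloisGroup E}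
    (hg : κ.IsTopGenerator (resGalOfEmb ι g)) {cneg : localPoints W E} {c : ℕ → localPoints W E}
    (hH : IsHondaSystem κ ι W ap g cneg c)
    (hL : ∃ H : AddSubgroup (localPoints W E), H ≤ localLayerPointsOfEmb κ ι W 2 ∧
      (H.addSubgroupOf (localLayerPointsOfEmb κ ι W 2)).FiniteIndex ∧
      Nonempty (H ≃+ (Fin (localLayerSubgroupOfEmb κ ι 2).index → ℤ_[p]))) :
    ∃ z₀ z₁ : localLayerPointsOfEmb κ ι W 2 →+ ℤ_[p],
      ¬ (p : ℤ_[p]) ∣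
        evalOn W (localLayerPointsOfEmb κ ι W 2) z₀ cneg *
            evalOn W (localLayerPointsOfEmb κ ι W 2) z₁
              (∑ j ∈ range (p ^ 2), (j.choose p) • (g ^ j • c 2) - 2 • ∑ j ∈ range p, j • (g ^ j • c 1)) -
          evalOn W (localLayerPointsOfEmb κ ι W 2) z₁ cneg *
            evalOn W (localLayerPointsOfEmb κ ι W 2) z₀
              (∑ j ∈ range (p ^ 2), (j.choose p) • (g ^ j • c 2) - 2 • ∑ j ∈ range p, j • (g ^ j • c 1)) := by
  have hp : p.Prime := Fact.out
  have hp3 : 3 ≤ p := by have := hp.two_le; omega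
  have hA : localLayerPointsOfEmb κ ι W 2 ≤ localLayerPointsOfEmb κ ι W 2 := le_rfl
  have hu := isUnit_hondaUnit (p := p) hap
  set t : ℤ_[p] := ((hu.unit⁻¹ : ℤ_[p]ˣ) : ℤ_[p]) with ht
  have hut : (((ap * (ap - 2) - ((p : ℤ) - 1) : ℤ) : ℤ_[p])) * t = 1 := hu.mul_val_inv
  -- the two functionals by their free coordinates
  obtain ⟨z₀, hy₀, hx₀⟩ := exists_functional_of_coordinates hap hg hH hL
    (fun r => if r = 0 then 1 else 0)
    (fun r i => if i = 0 then (ap : ℤ_[p]) * (if r = 0 then 1 else 0) - ((ap - 2 : ℤ) : ℤ_[p]) * t else 0)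
  obtain ⟨z₁, hy₁, hx₁⟩ := exists_functional_of_coordinates hap hg hH hL (fun _ => 0)
    (fun r i => if r = 0 then (if i = 1 then 1 else 0) - (if i = 0 then 1 else 0) else 0)
  -- values at `c₋₁`
  have hneg₀ : evalOn W (localLayerPointsOfEmb κ ι W 2) z₀ cneg = t := by
    have h := hondaUnit_mul_evalOn_cneg hA hg hH z₀
    rw [sum_congr rfl fun k hk => hy₀ k (mem_range.mp hk), sum_ite_eq', if_pos (mem_range.mpr hp.pos)] at h
    calc evalOn W (localLayerPointsOfEmb κ ι W 2) z₀ cneg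
        = t * ((((ap * (ap - 2) - ((p : ℤ) - 1) : ℤ) : ℤ_[p])) * evalOn W (localLayerPointsOfEmb κ ι W 2) z₀ cneg) := by
          rw [← mul_assoc, mul_comm t, hut, one_mul]
      _ = t := by rw [h, mul_one]
  have hneg₁ : evalOn W (localLayerPointsOfEmb κ ι W 2) z₁ cneg = 0 := by
    have h := hondaUnit_mul_evalOn_cneg hA hg hH z₁
    rw [sum_eq_zero fun k hk => hy₁ k (mem_range.mp hk)] at h
    exact hu.mul_right_eq_zero.mp h
  -- the `c_1`-orbit values
  have hY₀ : ∀ j, evalOn W (localLayerPointsOfEmb κ ι W 2) z₀ (g ^ j • c 1) = if j % p = 0 then 1 else 0 := fun j => by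
    rw [evalOn_pow_smul_honda_one hg hH z₀ j, hy₀ _ (Nat.mod_lt _ hp.pos)]
  have hY₁ : ∀ j, evalOn W (localLayerPointsOfEmb κ ι W 2) z₁ (g ^ j • c 1) = 0 := fun j => by
    rw [evalOn_pow_smul_honda_one hg hH z₁ j, hy₁ _ (Nat.mod_lt _ hp.pos)]
  -- the `c_2`-orbit values of `z₀`: supported on `j < p`
  have hX₀ : ∀ j < p ^ 2, evalOn W (localLayerPointsOfEmb κ ι W 2) z₀ (g ^ j • c 2) =
      if j < p then (ap : ℤ_[p]) * (if j = 0 then 1 else 0) - ((ap - 2 : ℤ) : ℤ_[p]) * t else 0 := by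
    intro j hj
    have hi : j / p < p := Nat.div_lt_of_lt_mul (by rwa [← pow_two])
    rcases (Nat.le_sub_one_of_lt hi).lt_or_eq with hlt | heq
    · have h := hx₀ (j % p) (Nat.mod_lt _ hp.pos) (j / p) hlt
      rw [Nat.mod_add_div] at h
      rw [h]
      by_cases hjp : j < p
      · rw [if_pos (Nat.div_eq_of_lt hjp), if_pos hjp, Nat.mod_eq_of_lt hjp]
      · have h0 : j / p ≠ 0 := by
          intro h0
          have e := Nat.mod_add_div j p
          rw [h0, mul_zero, add_zero] at e
          exact hjp (e ▸ Nat.mod_lt _ hp.pos)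
        rw [if_neg h0, if_neg hjp]
    · have h := evalOn_pow_smul_honda_two_last hA hg hH z₀ (j % p)
      have hj' : g ^ j • c 2 = g ^ (j % p + p * (p - 1)) • c 2 := by rw [← heq, Nat.mod_add_div]
      rw [hj', h, hY₀ (j % p), Nat.mod_mod, hneg₀,
        sum_congr rfl fun i hi => hx₀ (j % p) (Nat.mod_lt _ hp.pos) i (mem_range.mp hi),
        sum_ite_eq' (range (p - 1)), if_pos (mem_range.mpr (by omega))]
      have hjp : ¬ j < p := by
        intro hjp
        rw [Nat.div_eq_of_lt hjp] at heq
        omega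
      rw [if_neg hjp]
      ring
  -- the `c_2`-orbit values of `z₁`: `δ_p − δ_0`
  have hX₁ : ∀ j < p ^ 2, evalOn W (localLayerPointsOfEmb κ ι W 2) z₁ (g ^ j • c 2) =
      (if j = p then 1 else 0) - (if j = 0 then 1 else 0) := by
    intro j hj
    have hi : j / p < p := Nat.div_lt_of_lt_mul (by rwa [← pow_two])
    rcases (Nat.le_sub_one_of_lt hi).lt_or_eq with hlt | heq
    · have h := hx₁ (j % p) (Nat.mod_lt _ hp.pos) (j / p) hlt
      rw [Nat.mod_add_div] at h
      rw [h]
      have e := Nat.div_add_mod j p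
      by_cases h0 : j % p = 0
      · rw [if_pos h0]
        rw [h0, add_zero] at e
        congr 1
        · by_cases h1 : j / p = 1
          · rw [if_pos h1, if_pos (by rw [← e, h1, mul_one])]
          · rw [if_neg h1, if_neg (fun hjp => h1 (by rw [hjp, Nat.div_self hp.pos]))]
        · by_cases h1 : j / p = 0
          · rw [if_pos h1, if_pos (by rw [← e, h1, mul_zero])]
          · rw [if_neg h1, if_neg (fun hj0 => h1 (by rw [hj0, Nat.zero_div]))]
      · have hjp : j ≠ p := fun h => h0 (by rw [h, Nat.mod_self])
        have hj0 : j ≠ 0 := fun h => h0 (by rw [h, Nat.zero_mod])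
        rw [if_neg h0, if_neg hjp, if_neg hj0, sub_zero]
    · have h := evalOn_pow_smul_honda_two_last hA hg hH z₁ (j % p)
      have hj' : g ^ j • c 2 = g ^ (j % p + p * (p - 1)) • c 2 := by rw [← heq, Nat.mod_add_div]
      have hjp : j ≠ p := by
        intro h
        rw [h, Nat.div_self hp.pos] at heq
        omega
      have hj0 : j ≠ 0 := by
        intro h
        rw [h, Nat.zero_div] at heq
        omega
      rw [hj', h, hY₁, hneg₁, mul_zero, mul_zero, sub_zero, zero_sub,
        sum_congr rfl fun i hi => hx₁ (j % p) (Nat.mod_lt _ hp.pos) i (mem_range.mp hi), if_neg hjp, if_neg hj0,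
        sub_zero]
      by_cases hr : j % p = 0
      · simp only [hr, if_true]
        rw [sum_sub_distrib, sum_ite_eq' (range (p - 1)), sum_ite_eq' (range (p - 1)),
          if_pos (mem_range.mpr (by omega)), if_pos (mem_range.mpr (by omega)), sub_self, neg_zero]
      · simp only [hr, if_false, sum_const_zero, neg_zero]
  -- the values at `q`
  have hpp : p < p ^ 2 := by
    calc p = p ^ 1 := (pow_one p).symm
      _ < p ^ 2 := Nat.pow_lt_pow_right hp.one_lt (by norm_num)
  have hq₀ : evalOn W (localLayerPointsOfEmb κ ι W 2) z₀
      (∑ j ∈ range (p ^ 2), (j.choose p) • (g ^ j • c 2) - 2 • ∑ j ∈ range p, j • (g ^ j • c 1)) = 0 := by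
    rw [evalOn_honda_q_of_le hA hH z₀]
    have h1 : ∑ j ∈ range (p ^ 2), (j.choose p : ℤ_[p]) * evalOn W (localLayerPointsOfEmb κ ι W 2) z₀ (g ^ j • c 2) = 0 := by
      refine sum_eq_zero fun j hj => ?_
      rw [hX₀ j (mem_range.mp hj)]
      by_cases hjp : j < p
      · rw [Nat.choose_eq_zero_of_lt hjp, Nat.cast_zero, zero_mul]
      · rw [if_neg hjp, mul_zero]
    have h2 : ∑ j ∈ range p, (j : ℤ_[p]) * evalOn W (localLayerPointsOfEmb κ ι W 2) z₀ (g ^ j • c 1) = 0 := by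
      refine sum_eq_zero fun j hj => ?_
      rw [hY₀ j, Nat.mod_eq_of_lt (mem_range.mp hj)]
      by_cases h0 : j = 0
      · rw [h0, Nat.cast_zero, zero_mul]
      · rw [if_neg h0, mul_zero]
    rw [h1, h2, mul_zero, sub_zero]
  have hq₁ : evalOn W (localLayerPointsOfEmb κ ι W 2) z₁
      (∑ j ∈ range (p ^ 2), (j.choose p) • (g ^ j • c 2) - 2 • ∑ j ∈ range p, j • (g ^ j • c 1)) = 1 := by
    rw [evalOn_honda_q_of_le hA hH z₁]
    have h1 : ∑ j ∈ range (p ^ 2), (j.choose p : ℤ_[p]) * evalOn W (localLayerPointsOfEmb κ ι W 2) z₁ (g ^ j • c 2) = 1 := by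
      rw [sum_congr rfl fun j hj => by rw [hX₁ j (mem_range.mp hj)]]
      simp only [mul_sub, mul_ite, mul_one, mul_zero]
      rw [sum_sub_distrib, sum_ite_eq' (range (p ^ 2)), sum_ite_eq' (range (p ^ 2)), if_pos (mem_range.mpr hpp),
        if_pos (mem_range.mpr (pow_pos hp.pos 2)), Nat.choose_self, Nat.choose_eq_zero_of_lt hp.pos, Nat.cast_one,
        Nat.cast_zero, sub_zero]
    have h2 : ∑ j ∈ range p, (j : ℤ_[p]) * evalOn W (localLayerPointsOfEmb κ ι W 2) z₁ (g ^ j • c 1) = 0 :=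
      sum_eq_zero fun j _ => by rw [hY₁, mul_zero]
    rw [h1, h2, mul_zero, sub_zero]
  refine ⟨z₀, z₁, ?_⟩
  rw [hneg₀, hneg₁, hq₀, hq₁, mul_one, zero_mul, sub_zero]
  exact isUnit_iff_not_dvd.mp (Units.isUnit _)

/-! ## §2 (IND): `c₋₁` and `q` are `𝔽_p`-independent in `E(K_∞·K_v)/p` -/

/-- **(IND) — the point-independence clause of the (SES-KP) cokernel, PROVED** (any base `K`, any `ℤ_p`-extension, any place;
`p` odd, `p ∣ a_p`, `g` a lift of the topological generator, `(c₋₁, c)` a Honda system): IF the tower `E(K_∞·K_v)` has no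
`p`-torsion (Lemma 2.3) and `E(K_2·K_v)` contains a finite-index subgroup `≅ ℤ_p^{[Γ_{K_v} : Gal(K̄_v/K_2·K_v)]}` (Silverman
VII.6.3), THEN for `y ∈ E(K_∞·K_v)` and integers `m₀, m₁` with `p·y = m₀·c₋₁ + m₁·q`,
`q = ∑_{j<p²} C(j,p)·gʲc_2 − 2·∑_{j<p} j·gʲc_1`, both `m₀` and `m₁` are divisible by `p`. Proof: `y ∈ E(K_2·K_v)`
(saturation of the layer in the torsion-free tower), apply the two functionals of `exists_pair_det_not_dvd`, Cramer.
This is exactly the hypothesis `hind` of `forall_exists_isColemanPair_X_mul_of_independent` / `…_rat`.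
[cite: Sprung2012, Thm. 2.2, Lemma 2.3 (pp. 1487–1488), Cor. 2.10 (p. 1489), §7.1 (pp. 1500–1501)]
[cite: SilvermanAEC2009, VII Prop. 6.3] [cite: KuriharaPollack2007, Prop. 1.2] [cite: LeiSujatha2021, §3 (SES-KP)] -/
theorem honda_independent {ap : ℤ} (hap : (p : ℤ) ∣ ap) (hp2 : p ≠ 2) {g : Field.absoluteGaloisGroup E}
    (hg : κ.IsTopGenerator (resGalOfEmb ι g)) {cneg : localPoints W E} {c : ℕ → localPoints W E}
    (hH : IsHondaSystem κ ι W ap g cneg c)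
    (hN : ∀ P : localPoints W E, P ∈ localTowerPointsOfEmb κ ι W → p • P = 0 → P = 0)
    (hL : ∃ H : AddSubgroup (localPoints W E), H ≤ localLayerPointsOfEmb κ ι W 2 ∧
      (H.addSubgroupOf (localLayerPointsOfEmb κ ι W 2)).FiniteIndex ∧
      Nonempty (H ≃+ (Fin (localLayerSubgroupOfEmb κ ι 2).index → ℤ_[p]))) :
    ∀ (m₀ m₁ : ℤ) (y : localPoints W E), y ∈ localTowerPointsOfEmb κ ι W →
      p • y = m₀ • cneg + m₁ • (∑ j ∈ range (p ^ 2), (j.choose p) • (g ^ j • c 2) -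
        2 • ∑ j ∈ range p, j • (g ^ j • c 1)) →
      (p : ℤ) ∣ m₀ ∧ (p : ℤ) ∣ m₁ := by
  intro m₀ m₁ y hy hpy
  have hA : localLayerPointsOfEmb κ ι W 2 ≤ localLayerPointsOfEmb κ ι W 2 := le_rfl
  obtain ⟨hc2A, hc1A, hcnegA⟩ := honda_orbit_mem hA hH
  have hQA : (∑ j ∈ range (p ^ 2), (j.choose p) • (g ^ j • c 2) - 2 • ∑ j ∈ range p, j • (g ^ j • c 1)) ∈
      localLayerPointsOfEmb κ ι W 2 :=
    sub_mem (AddSubgroup.sum_mem _ fun j _ => AddSubgroup.nsmul_mem _ (hc2A j) _)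
      (AddSubgroup.nsmul_mem _ (AddSubgroup.sum_mem _ fun j _ => AddSubgroup.nsmul_mem _ (hc1A j) _) _)
  -- `y ∈ E(K_2·K_v)`
  have hyA : y ∈ localLayerPointsOfEmb κ ι W 2 := by
    refine mem_localLayerPointsOfEmb_of_pow_nsmul_mem κ ι W hN hy (k := 1) ?_
    rw [pow_one, hpy]
    exact add_mem (zsmul_mem hcnegA _) (zsmul_mem hQA _)
  obtain ⟨z₀, z₁, hdet⟩ := exists_pair_det_not_dvd hap hp2 hg hH hL
  -- apply the functionals
  have happly : ∀ z : localLayerPointsOfEmb κ ι W 2 →+ ℤ_[p],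
      (p : ℤ_[p]) * evalOn W (localLayerPointsOfEmb κ ι W 2) z y =
        (m₀ : ℤ_[p]) * evalOn W (localLayerPointsOfEmb κ ι W 2) z cneg +
          (m₁ : ℤ_[p]) * evalOn W (localLayerPointsOfEmb κ ι W 2) z
            (∑ j ∈ range (p ^ 2), (j.choose p) • (g ^ j • c 2) - 2 • ∑ j ∈ range p, j • (g ^ j • c 1)) := by
    intro z
    rw [← evalOn_map_nsmul_of_mem _ z hyA, hpy, evalOn_map_add_of_mem _ z (zsmul_mem hcnegA _) (zsmul_mem hQA _),
      evalOn_map_zsmul_of_mem _ z hcnegA, evalOn_map_zsmul_of_mem _ z hQA]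
  have h₀ := happly z₀
  have h₁ := happly z₁
  set a₀ := evalOn W (localLayerPointsOfEmb κ ι W 2) z₀ cneg with ha₀
  set a₁ := evalOn W (localLayerPointsOfEmb κ ι W 2) z₁ cneg with ha₁
  set b₀ := evalOn W (localLayerPointsOfEmb κ ι W 2) z₀
    (∑ j ∈ range (p ^ 2), (j.choose p) • (g ^ j • c 2) - 2 • ∑ j ∈ range p, j • (g ^ j • c 1)) with hb₀
  set b₁ := evalOn W (localLayerPointsOfEmb κ ι W 2) z₁
    (∑ j ∈ range (p ^ 2), (j.choose p) • (g ^ j • c 2) - 2 • ∑ j ∈ range p, j • (g ^ j • c 1)) with hb₁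
  have hD : IsUnit (a₀ * b₁ - a₁ * b₀) := isUnit_iff_not_dvd.mpr hdet
  -- Cramer
  have hm₀ : (p : ℤ_[p]) ∣ (m₀ : ℤ_[p]) * (a₀ * b₁ - a₁ * b₀) := by
    have e : (m₀ : ℤ_[p]) * (a₀ * b₁ - a₁ * b₀) =
        ((m₀ : ℤ_[p]) * a₀ + (m₁ : ℤ_[p]) * b₀) * b₁ - ((m₀ : ℤ_[p]) * a₁ + (m₁ : ℤ_[p]) * b₁) * b₀ := by ring
    rw [e, ← h₀, ← h₁]
    exact dvd_sub (dvd_mul_of_dvd_left (dvd_mul_right _ _) _) (dvd_mul_of_dvd_left (dvd_mul_right _ _) _)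
  have hm₁ : (p : ℤ_[p]) ∣ (m₁ : ℤ_[p]) * (a₀ * b₁ - a₁ * b₀) := by
    have e : (m₁ : ℤ_[p]) * (a₀ * b₁ - a₁ * b₀) =
        a₀ * ((m₀ : ℤ_[p]) * a₁ + (m₁ : ℤ_[p]) * b₁) - a₁ * ((m₀ : ℤ_[p]) * a₀ + (m₁ : ℤ_[p]) * b₀) := by ring
    rw [e, ← h₀, ← h₁]
    exact dvd_sub (dvd_mul_of_dvd_right (dvd_mul_right _ _) _) (dvd_mul_of_dvd_right (dvd_mul_right _ _) _)
  rw [hD.dvd_mul_right] at hm₀ hm₁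
  have hcast : ∀ m : ℤ, (p : ℤ_[p]) ∣ (m : ℤ_[p]) → (p : ℤ) ∣ m := fun m hm => by
    have h := (PadicInt.pow_p_dvd_int_iff 1 m).mp (by rwa [pow_one])
    rwa [pow_one] at h
  exact ⟨hcast m₀ hm₀, hcast m₁ hm₁⟩

end Local

/-! ## §3 Over `ℚ` at an odd supersingular prime: (IND) and the (SES-KP) cokernel modulo Silverman VII.6.3 only -/

section Rat

open NumberField IsDedekindDomain

/-- **(IND) over `ℚ`** — `W/ℚ` elliptic globally minimal, `p ≠ 2` good supersingular (`p ∣ a_p`), any `ℤ_p`-extension `κ`,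
`v ∋ p`, any embedding `ι`, `g` a lift of the topological generator, `(c₋₁, c)` a Honda system; CONDITIONAL on the named
fact `silvermanVII63_localLayerPoints_finiteIndex_zpLattice` (Silverman AEC VII.6.3; its `K = ℚ` shape `….rat`): `c₋₁` and
`q` are `𝔽_p`-independent in `E(ℚ_∞·ℚ_p)/p`. (No `p`-torsion in the tower: Lemma 2.3, discharged in `LocalTowerNoPTorsionProofs`.)
[cite: Sprung2012, Thm. 2.2, Lemma 2.3 (pp. 1487–1488)] [cite: SilvermanAEC2009, VII Prop. 6.3] -/
theorem honda_independent_rat (h63 : silvermanVII63_localLayerPoints_finiteIndex_zpLattice)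
    (W : WeierstrassCurve ℚ) [W.IsElliptic] [W.IsGloballyMinimal] (p : ℕ) [Fact p.Prime] (hp2 : p ≠ 2)
    (hgood : W.HasGoodReductionAtPrime p) (hap : (p : ℤ) ∣ W.frobeniusTrace p) (κ : ZpExtension ℚ p)
    {v : HeightOneSpectrum (𝓞 ℚ)} (hpv : (p : 𝓞 ℚ) ∈ v.asIdeal)
    (ι : AlgebraicClosure ℚ →ₐ[ℚ] AlgebraicClosure (v.adicCompletion ℚ))
    {g : Field.absoluteGaloisGroup (v.adicCompletion ℚ)} (hg : κ.IsTopGenerator (resGalOfEmb ι g))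
    {cneg : localPoints W (v.adicCompletion ℚ)} {c : ℕ → localPoints W (v.adicCompletion ℚ)}
    (hH : IsHondaSystem κ ι W (W.frobeniusTrace p) g cneg c) :
    ∀ (m₀ m₁ : ℤ) (y : localPoints W (v.adicCompletion ℚ)), y ∈ localTowerPointsOfEmb κ ι W →
      p • y = m₀ • cneg + m₁ • (∑ j ∈ range (p ^ 2), (j.choose p) • (g ^ j • c 2) -
        2 • ∑ j ∈ range p, j • (g ^ j • c 1)) →
      (p : ℤ) ∣ m₀ ∧ (p : ℤ) ∣ m₁ :=
  honda_independent hap hp2 hg hH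
    (fun _ hP hpP ↦ eq_zero_of_mem_localTowerPointsOfEmb_of_prime_nsmul W p hp2 hgood hap κ hpv ι hP hpP)
    (silvermanVII63_localLayerPoints_finiteIndex_zpLattice.rat h63 κ hpv ι W 2)

/-- **(SES-KP), cokernel half, over `ℚ` — conditional ONLY on Silverman VII.6.3**: `W/ℚ` elliptic globally minimal, `p ≠ 2`
good supersingular, any `ℤ_p`-extension `κ`, `v ∋ p`, the chosen embedding, `g` a lift of the topological generator, `(c₋₁, c)`
a Honda system: every `(T·x, T·y) ∈ T·Λ²` is a Coleman value `Col(z)` — `forall_exists_isColemanPair_X_mul_rat` with its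
hypothesis (IND) discharged by `honda_independent_rat`. [cite: Sprung2012, Thm. 2.2, Lemma 2.3 (p. 1487), Def. 5.9 (p. 1495), Props. 7.3/7.6 (pp. 1500–1501)]
[cite: KuriharaPollack2007, Prop. 1.2] [cite: LeiSujatha2021, §3 (SES-KP)] [cite: SilvermanAEC2009, VII Prop. 6.3] -/
theorem forall_exists_isColemanPair_X_mul_rat_of_silvermanVII63 (h63 : silvermanVII63_localLayerPoints_finiteIndex_zpLattice)
    (W : WeierstrassCurve ℚ) [W.IsElliptic] [W.IsGloballyMinimal] (p : ℕ) [Fact p.Prime] (hp2 : p ≠ 2)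
    (hgood : W.HasGoodReductionAtPrime p) (hap : (p : ℤ) ∣ W.frobeniusTrace p) (κ : ZpExtension ℚ p)
    {v : HeightOneSpectrum (𝓞 ℚ)} (hpv : (p : 𝓞 ℚ) ∈ v.asIdeal)
    {g : Field.absoluteGaloisGroup (v.adicCompletion ℚ)}
    (hg : κ.IsTopGenerator (resGalOfEmb (closureEmb (K := ℚ) (v.adicCompletion ℚ)) g))
    {cneg : localPoints W (v.adicCompletion ℚ)} {c : ℕ → localPoints W (v.adicCompletion ℚ)}
    (hH : IsHondaSystem κ (closureEmb (K := ℚ) (v.adicCompletion ℚ)) W (W.frobeniusTrace p) g cneg c) :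
    ∀ x y : IwasawaAlgebra p, ∃ z : localTowerPointsOfEmb κ (closureEmb (K := ℚ) (v.adicCompletion ℚ)) W →+ ℤ_[p],
      IsColemanPair κ (closureEmb (K := ℚ) (v.adicCompletion ℚ)) W (W.frobeniusTrace p) g c z
        (PowerSeries.X * x) (PowerSeries.X * y) :=
  forall_exists_isColemanPair_X_mul_rat W p hp2 hgood hap κ hpv hg hH
    (honda_independent_rat h63 W p hp2 hgood hap κ hpv _ hg hH)

/-- **The joint Coleman map over `ℚ` at an odd supersingular prime in the shape of the F-α skeleton's hypotheses, conditional
ONLY on Silverman VII.6.3**: an INJECTIVE `Λ`-linear `J : H¹_Iw(T) → Λ × Λ` with `Col(z) = J z`, `T·Λ² ⊆ range J`, and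
`ℓ_𝔭(Λ²/range J) = 0` at every prime `𝔭 ∌ T` (the exact sequence (SES-KP); `exists_linearMap_isColemanPair_cokernel_rat` with
(IND) discharged) — the hypotheses `J`/`hJ`/`hcoker` of `min_lengthAt_quotient_range_le_lengthAt_torsion_of_skeleton` (Summits,
crux `KatoFineLowerSporadicX8`) for the functional model. [cite: Sprung2012, Def. 5.9 (p. 1495), Def. 7.1–7.2, Props. 7.3/7.6 (pp. 1500–1501), Thm. 2.2 / Lemma 2.3 (p. 1487)]
[cite: KuriharaPollack2007, Prop. 1.2] [cite: LeiSujatha2021, §3 (SES-KP)] [cite: SilvermanAEC2009, VII Prop. 6.3] -/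
theorem exists_linearMap_isColemanPair_cokernel_rat_of_silvermanVII63
    (h63 : silvermanVII63_localLayerPoints_finiteIndex_zpLattice)
    (W : WeierstrassCurve ℚ) [W.IsElliptic] [W.IsGloballyMinimal] (p : ℕ) [Fact p.Prime] (hp2 : p ≠ 2)
    (hgood : W.HasGoodReductionAtPrime p) (hap : (p : ℤ) ∣ W.frobeniusTrace p) (κ : ZpExtension ℚ p)
    {v : HeightOneSpectrum (𝓞 ℚ)} (hpv : (p : 𝓞 ℚ) ∈ v.asIdeal)
    {g : Field.absoluteGaloisGroup (v.adicCompletion ℚ)}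
    (hg : κ.IsTopGenerator (resGalOfEmb (closureEmb (K := ℚ) (v.adicCompletion ℚ)) g))
    {cneg : localPoints W (v.adicCompletion ℚ)} {c : ℕ → localPoints W (v.adicCompletion ℚ)}
    (hH : IsHondaSystem κ (closureEmb (K := ℚ) (v.adicCompletion ℚ)) W (W.frobeniusTrace p) g cneg c) :
    letI := moduleOfGenerator κ (closureEmb (K := ℚ) (v.adicCompletion ℚ)) W hg
    ∃ J : (localTowerPointsOfEmb κ (closureEmb (K := ℚ) (v.adicCompletion ℚ)) W →+ ℤ_[p]) →ₗ[IwasawaAlgebra p]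
        IwasawaAlgebra p × IwasawaAlgebra p,
      (∀ z, IsColemanPair κ (closureEmb (K := ℚ) (v.adicCompletion ℚ)) W (W.frobeniusTrace p) g c z (J z).1 (J z).2) ∧
      Function.Injective J ∧
      (∀ x y : IwasawaAlgebra p, ∃ z, J z = (PowerSeries.X * x, PowerSeries.X * y)) ∧
      ∀ 𝔭 : PrimeSpectrum (IwasawaAlgebra p), (PowerSeries.X : IwasawaAlgebra p) ∉ 𝔭.asIdeal →
        Module.lengthAt (IwasawaAlgebra p) ((IwasawaAlgebra p × IwasawaAlgebra p) ⧸ LinearMap.range J) 𝔭 = 0 :=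
  exists_linearMap_isColemanPair_cokernel_rat W p hp2 hgood hap κ hpv hg hH
    (honda_independent_rat h63 W p hp2 hgood hap κ hpv _ hg hH)

end Rat

end Literature.NumberTheory.EllipticCurves.Sprung2012

end
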